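/-
COR-CM (cell pub-hodgecm2, stage 2 of the Hodge ladder) — count-neutral KERNEL COMBINATORICS «the octic product column G = Q₈ × B, D₄ × B: transport to the intrinsic currency»
(seat prover-pub-hodgecm2-b23-g45-0, binder prover b23, gen 45; own census lane OCTIC-PRODUCT, claim HOME/INBOX.md l.18829).  Bookkeeping definitions with bodies (`tr`, `gfOf`, `blockEquiv`) + theorems — gen 44ʼs `Census/QuarticInversionTransport.lean` along an octic product datum (base change along `y` = the motion `twZ` of the central `y`); no `decide` beyond closed identities in `ZMod 2`/`Fin 4`, no certificate, no named fact, no `sorry`.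
`Interfaces.lean` (C1), every E term, B01, `Transposition/*`, `PortJoin/*`, `D2Bridge/*` untouched.
HONEST FRAMING: `HC_CM` is NOT proved, here or anywhere in the tree; nothing here is a period, a count of record or a headline.
T5: n/a-class (hypothesis binders = the datum equations / the slot data only); checker: self, 2026-08-24.
-/
import Summits.HodgeConjecture.CorCM.Census.OcticProductPlaces
import Summits.HodgeConjecture.CorCM.Census.OcticProductGeneration
import Summits.HodgeConjecture.CorCM.Census.TwistGenerationDescent

/-!
# The octic product column: transport of the count to the intrinsic currency

COR-CM (cell `pub-hodgecm2`, stage 2 of the Hodge ladder), count-neutral KERNEL COMBINATORICS by the binder seat b23 (gen 45; lane OCTIC-PRODUCT, HOME/INBOX.md l.18829 — the port of gen 44ʼs quartic inversion lane `Census/QuarticInversion*` to the datum with `y` CENTRAL on `ι(H₀)`).  On top of the corresponding parts of gen 44ʼs lane `Census/QuarticInversion*` (label-level, BY NAME) and the preceding `Census/OcticProduct*` files; the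
intrinsic currency (`CorCM/Prior/AllgGroup1.lean`, `Census/BlockParityLaw.lean`, `Census/CoinvariantFibre.lean`) BY NAME.  Bookkeeping
definitions with bodies (`tr`, `gfOf`, `blockEquiv`) + theorems (base-change stability of `ℤ⟨translates⟩` from `Census/TwistGenerationDescent.lean`, of pairs from
`Census/CoinvariantFibre.lean`, BY NAME); no `decide`, no certificate, no named fact, no geometry, no `sorry`.
`Interfaces.lean` (C1), every E term, B01, `Transposition/*`, `PortJoin/*`, `D2Bridge/*` untouched.
HONEST FRAMING: `HC_CM` is NOT proved, here or anywhere in the tree; nothing here is a period, a count of record or a headline.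

CONTENT (a datum `D : Datum G c A ζ`).  Along the dictionary `typeEquiv D : CMF G c ≃ Ty₄ A` the linear transport
`tr D : ℤ^{Ty₄ A} ≃ₗ ℤ[CMF G c]`, `e_Θ ↦ [typeOf Θ]`, carries
* §2 the model's pairs to the pairs of the currency (`tr_pairVec₄`, `map_pairs₄`), §3 the model's motions to base change
  (`tr_translH₄`, `tr_translZ`, `tr_translT`), §4 the model's faces to abstract faces PLUS TWO PAIRS (`tr_faceVec₄`; so every abstract face
  `gface Φ t t'`, `t' ∉ {t, ct}`, is a transported Hodge vector up to pairs, `gface_mem`), §5 model face classes to attached abstract faces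
  (`gfOf`, `gfOf_spec`), §6 the blocks of `(G, c)` to the blocks of the model (`blockEquiv`, `card_block_eq`), and §7 any family `F` of model
  faces with `hodge₄ ≤ pairs₄ ⊔ orbSpan F` to the family `F.image gfOf` of abstract faces (`image_gfOf_subset_gfaceSet`) whose base changes together
  with the pairs span `hodgeSpan c` (`hodgeSpan_le_of_family`).  All [folklore].

## References
* [Pohlmann1968] H. Pohlmann, Algebraic cycles on abelian varieties of complex multiplication type, Ann. of Math. 88 (1968), Thm 1.
* [Milne1999] J. S. Milne, Lefschetz motives and the Tate conjecture, Compositio Math. 117 (1999), Prop. 2.1, p. 54.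
-/

namespace Summit.HodgeConjecture.CorCM.Census.OcticProduct

open Finset
open Summit.HodgeConjecture.CorCM.Prior.AllgGroup.RfwfAllgGroup
open Summit.HodgeConjecture.CorCM.Census.BlockParity
open Summit.HodgeConjecture.CorCM.Census.Coinvariant
open Summit.HodgeConjecture.CorCM.Census.OddSliceFacesModel

open Summit.HodgeConjecture.CorCM.Census.QuarticInversion (Pl Ty₄ conj₄ conj₄_eq_twH₄ faceVec₄ faceVec₄_mem flipAt hodge₄ hv pairVec₄ pairs₄ translH₄ translH₄Hom translH₄Hom_apply translH₄_single translT translTHom translTHom_apply translT_single twH₄ twT Φ)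

noncomputable section

variable {G : Type*} [Group G] [Fintype G] [DecidableEq G] {c : G}
variable {A : Type} [AddCommGroup A] [Fintype A] [DecidableEq A] {ζ : ZMod 2}
variable (D : Datum G c A ζ)

/-! ## §1 The transport isomorphism -/

/-- **The transport** `e_Θ ↦ [typeOf Θ]`. [folklore] -/
def tr : (Ty₄ A → ℤ) ≃ₗ[ℤ] (CMF G c →₀ ℤ) :=
  (Finsupp.linearEquivFunOnFinite ℤ ℤ (Ty₄ A)).symm ≪≫ₗ Finsupp.domLCongr (typeEquiv D).symm

omit [DecidableEq A] in
/-- **Unit vectors go to types** (through the dictionary `typeEquiv`). [folklore] -/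
private theorem tr_single₄ (Θ : Ty₄ A) (n : ℤ) : tr D (Pi.single Θ n) = Finsupp.single ((typeEquiv D).symm Θ) n := by
  rw [tr, LinearEquiv.trans_apply, Finsupp.linearEquivFunOnFinite_symm_single, Finsupp.domLCongr_single]

/-- A vector is the sum of its transported unit vectors (through the dictionary). [folklore] -/
private theorem tr_eq_sum₄ (v : Ty₄ A → ℤ) : tr D v = ∑ Θ, Finsupp.single ((typeEquiv D).symm Θ) (v Θ) := by
  conv_lhs => rw [← Finset.univ_sum_single v]
  rw [map_sum]
  exact Finset.sum_congr rfl fun Θ _ => tr_single₄ D Θ (v Θ)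

/-! ## §2 Pairs -/

omit [DecidableEq A] in
/-- The type of the conjugate label is the base change along `c`. [folklore] -/
private theorem typeOf_conj₄ (Θ : Ty₄ A) : typeOf D (conj₄ A Θ) = rt c c (typeOf D Θ) := by
  rw [conj₄_eq_twH₄, ← typeOf_twH₄, D.map_c]

omit [DecidableEq A] in
/-- **Pairs go to pairs.** [folklore] -/
private theorem tr_pairVec₄ (Θ : Ty₄ A) : tr D (pairVec₄ A Θ) = pair c (typeOf D Θ) := by
  rw [pairVec₄, map_add, tr_single₄, tr_single₄, typeEquiv_symm_apply, typeEquiv_symm_apply, pair, typeOf_conj₄]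

omit [DecidableEq A] in
/-- **The divisor lattices agree**: `tr (pairs₄ A) = ℤ⟨pairSet c⟩`. [folklore] -/
private theorem map_pairs₄ : (pairs₄ A).map (tr D : (Ty₄ A → ℤ) →ₗ[ℤ] (CMF G c →₀ ℤ)) = Submodule.span ℤ (pairSet c) := by
  rw [pairs₄, Submodule.map_span, ← Set.range_comp]
  have h : ((tr D : (Ty₄ A → ℤ) →ₗ[ℤ] (CMF G c →₀ ℤ)) ∘ pairVec₄ A) = pair c ∘ typeOf D :=
    funext fun Θ => by rw [Function.comp_apply, Function.comp_apply, LinearEquiv.coe_coe, tr_pairVec₄]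
  have hsurj : Function.Surjective (typeOf (c := c) D) := (typeEquiv D).symm.surjective
  rw [h, hsurj.range_comp]
  rfl

omit [Fintype A] [DecidableEq A] in
include D in
/-- **`ℤ⟨pairSet⟩` is base-change stable** (map form; `c` central along the datum). [folklore] -/
private theorem span_pairSet_map_rt_le (Q : G) :
    (Submodule.span ℤ (pairSet c)).map (Finsupp.lmapDomain ℤ ℤ (rt c Q)) ≤ Submodule.span ℤ (pairSet c) := by
  rw [Submodule.map_span, Submodule.span_le]
  rintro _ ⟨z, ⟨Ψ, rfl⟩, rfl⟩
  exact Submodule.subset_span ⟨rt c Q Ψ, by rw [Finsupp.lmapDomain_apply]; exact (mapDomain_rt_pair_eq c (mul_c_comm D) Q Ψ).symm⟩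

/-! ## §3 Motions are base changes -/

/-- **`tr (h_a · v) = (tr v)·(ι a)⁻¹`.** [folklore] -/
private theorem tr_translH₄ (a : ZMod 2 × A) (v : Ty₄ A → ℤ) : tr D (translH₄ A a v) = Finsupp.mapDomain (rt c (D.ι a)) (tr D v) := by
  have hv : translH₄ A a v = translH₄Hom A a (∑ Θ, Pi.single Θ (v Θ)) := by rw [translH₄Hom_apply, Finset.univ_sum_single]
  rw [hv, map_sum, map_sum, tr_eq_sum₄ D v, Finsupp.mapDomain_finsetSum]
  refine Finset.sum_congr rfl fun Θ _ => ?_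
  rw [translH₄Hom_apply, translH₄_single, tr_single₄, typeEquiv_symm_apply, typeEquiv_symm_apply, ← typeOf_twH₄, Finsupp.mapDomain_single]

/-- **`tr (y · v) = (tr v)·y⁻¹`.** [folklore] -/
private theorem tr_translZ (v : Ty₄ A → ℤ) : tr D (translZ A ζ v) = Finsupp.mapDomain (rt c D.y) (tr D v) := by
  have hv : translZ A ζ v = translZHom A ζ (∑ Θ, Pi.single Θ (v Θ)) := by rw [translZHom_apply, Finset.univ_sum_single]
  rw [hv, map_sum, map_sum, tr_eq_sum₄ D v, Finsupp.mapDomain_finsetSum]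
  refine Finset.sum_congr rfl fun Θ _ => ?_
  rw [translZHom_apply, translZ_single, tr_single₄, typeEquiv_symm_apply, typeEquiv_symm_apply, typeOf_twZ, Finsupp.mapDomain_single]

/-- **`tr (t · v) = (tr v)·t⁻¹`.** [folklore] -/
private theorem tr_translT (v : Ty₄ A → ℤ) : tr D (translT A v) = Finsupp.mapDomain (rt c D.t) (tr D v) := by
  have hv : translT A v = translTHom A (∑ Θ, Pi.single Θ (v Θ)) := by rw [translTHom_apply, Finset.univ_sum_single]
  rw [hv, map_sum, map_sum, tr_eq_sum₄ D v, Finsupp.mapDomain_finsetSum]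
  refine Finset.sum_congr rfl fun Θ _ => ?_
  rw [translTHom_apply, translT_single, tr_single₄, typeEquiv_symm_apply, typeEquiv_symm_apply, ← typeOf_twT, Finsupp.mapDomain_single]

/-! ## §4 Faces: the model's faces are abstract faces plus two pairs -/

/-- **`tr (faceVec₄ Θ p q) = gface (typeOf Θ) (word p) (word q) + pair + pair`.** [folklore] -/
private theorem tr_faceVec₄ (hc2 : c * c = 1) (Θ : Ty₄ A) (p q : Pl A) :
    tr D (faceVec₄ A Θ p q) = gface c hc2 (typeOf D Θ) (word D p.1 (0, p.2)) (word D q.1 (0, q.2)) +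
      pair c (typeOf D (flipAt A p Θ)) + pair c (typeOf D (flipAt A q Θ)) := by
  rw [faceVec₄, map_add, map_add, map_add, tr_single₄, tr_single₄, tr_single₄, tr_single₄, typeEquiv_symm_apply, typeEquiv_symm_apply,
    typeEquiv_symm_apply, typeEquiv_symm_apply, gface, pair, pair, typeOf_conj₄, typeOf_conj₄,
    typeOf_flipAt D hc2 p (flipAt A q Θ), typeOf_flipAt D hc2 q Θ, typeOf_flipAt D hc2 p Θ]
  abel

omit [Fintype G] [Fintype A] [DecidableEq A] in
/-- The place of `word k (e, s)` is the place of `word k (0, s)`. [folklore] -/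
private theorem orb_word_mk (hc2 : c * c = 1) (k : Fin 4) (e : ZMod 2) (s : A) : orb c (word D k (e, s)) = orb c (word D k (0, s)) := by
  have h01 : ∀ u : ZMod 2, u = 0 ∨ u = 1 := by decide
  rcases h01 e with rfl | rfl
  · rfl
  · have hw : word D k (1, s) = c * word D k (0, s) := by
      rw [c_mul_word]; congr 1; ext <;> simp
    rw [hw, orb, orb, ← mul_assoc, hc2, one_mul, Finset.pair_comm]

omit [Fintype A] [DecidableEq A] in
/-- Flipping at `word k (e, s)` is flipping at `word k (0, s)`. [folklore] -/
private theorem oflipCM_word_mk (hc2 : c * c = 1) (k : Fin 4) (e : ZMod 2) (s : A) (X : CMF G c) :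
    oflipCM c hc2 (word D k (e, s)) X = oflipCM c hc2 (word D k (0, s)) X := by
  apply Subtype.ext
  show oflip c (word D k (e, s)) X.1 = oflip c (word D k (0, s)) X.1
  rw [oflip, oflip, orb_word_mk D hc2]

/-- **Every abstract face is a transported Hodge vector of the model up to two pairs.** [folklore] -/
private theorem gface_mem (hc2 : c * c = 1) (Φ : CMF G c) {t t' : G} (ht' : t' ∉ orb c t) :
    gface c hc2 Φ t t' ∈ (hodge₄ A).map (tr D : (Ty₄ A → ℤ) →ₗ[ℤ] (CMF G c →₀ ℤ)) ⊔ Submodule.span ℤ (pairSet c) := by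
  obtain ⟨k, ⟨e, s⟩, rfl⟩ := exists_word D t
  obtain ⟨k', ⟨e', s'⟩, rfl⟩ := exists_word D t'
  have hpq : ((k, s) : Pl A) ≠ (k', s') := fun h => ht' (by
    rw [word_mem_orb_word_iff]; exact ⟨(Prod.mk.inj h).1.symm, (Prod.mk.inj h).2.symm⟩)
  have hΦ : Φ = typeOf D (ty D Φ) := (typeOf_ty D Φ).symm
  have hP : ∀ Ψ : CMF G c, pair c Ψ ∈ Submodule.span ℤ (pairSet c) := fun Ψ => Submodule.subset_span (pair_mem_pairSet c Ψ)
  have e1 : gface c hc2 Φ (word D k (e, s)) (word D k' (e', s')) = gface c hc2 Φ (word D k (0, s)) (word D k' (0, s')) := by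
    simp only [gface, oflipCM_word_mk D hc2]
  have e2 := tr_faceVec₄ D hc2 (ty D Φ) (k, s) (k', s')
  rw [← hΦ] at e2
  have e3 : gface c hc2 Φ (word D k (0, s)) (word D k' (0, s')) = tr D (faceVec₄ A (ty D Φ) (k, s) (k', s')) -
      pair c (typeOf D (flipAt A (k, s) (ty D Φ))) - pair c (typeOf D (flipAt A (k', s') (ty D Φ))) := by
    rw [e2]; abel
  rw [e1, e3]
  exact Submodule.sub_mem _ (Submodule.sub_mem _ (Submodule.mem_sup_left ⟨_, faceVec₄_mem A _ hpq, rfl⟩)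
    (Submodule.mem_sup_right (hP _))) (Submodule.mem_sup_right (hP _))

/-! ## §5 The abstract face attached to a model face -/

/-- **The abstract face attached to a model face** `faceVec₄ Θ p q` (`p ≠ q`; a choice of presentation; junk `0` otherwise). [folklore] -/
def gfOf (hc2 : c * c = 1) (f : Ty₄ A → ℤ) : CMF G c →₀ ℤ :=
  if h : ∃ q : Ty₄ A × Pl A × Pl A, q.2.1 ≠ q.2.2 ∧ f = faceVec₄ A q.1 q.2.1 q.2.2 then
    gface c hc2 (typeOf D h.choose.1) (word D h.choose.2.1.1 (0, h.choose.2.1.2)) (word D h.choose.2.2.1 (0, h.choose.2.2.2))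
  else 0

/-- **The attached abstract face is an abstract face at two distinct places and differs from the transported class by two pairs.** [folklore] -/
private theorem gfOf_spec (hc2 : c * c = 1) {f : Ty₄ A → ℤ} (hf : ∃ Θ p q, p ≠ q ∧ f = faceVec₄ A Θ p q) :
    gfOf D hc2 f ∈ gfaceSet G c hc2 ∧ tr D f - gfOf D hc2 f ∈ Submodule.span ℤ (pairSet c) := by
  have h : ∃ q : Ty₄ A × Pl A × Pl A, q.2.1 ≠ q.2.2 ∧ f = faceVec₄ A q.1 q.2.1 q.2.2 := by
    obtain ⟨Θ, p, q, hpq, rfl⟩ := hf; exact ⟨(Θ, p, q), hpq, rfl⟩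
  have hP : ∀ Ψ : CMF G c, pair c Ψ ∈ Submodule.span ℤ (pairSet c) := fun Ψ => Submodule.subset_span (pair_mem_pairSet c Ψ)
  obtain ⟨hq, hfq⟩ := h.choose_spec
  rw [gfOf, dif_pos h]
  refine ⟨⟨_, _, _, word_not_mem_orb_of_ne D hq, rfl⟩, ?_⟩
  have e := tr_faceVec₄ D hc2 h.choose.1 h.choose.2.1 h.choose.2.2
  rw [← hfq] at e
  rw [e, show ∀ x y z : CMF G c →₀ ℤ, x + y + z - x = y + z from fun x y z => by abel]
  exact Submodule.add_mem _ (hP _) (hP _)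

/-! ## §6 Blocks -/

omit [Fintype A] [DecidableEq A] in
/-- A chain of motions from `ty Ψ` is realised by a base change. [folklore] -/
private theorem exists_rt_of_reach (Ψ : CMF G c) {Θ' : Ty₄ A}
    (h : Relation.ReflTransGen
      (fun Θ₁ Θ₂ : Ty₄ A => (∃ g : ZMod 2 × A, Θ₂ = twH₄ A g Θ₁) ∨ Θ₂ = twZ A ζ Θ₁ ∨ Θ₂ = twT A Θ₁) (ty D Ψ) Θ') :
    ∃ Q : G, ty D (rt c Q Ψ) = Θ' := by
  induction h with
  | refl => exact ⟨1, by rw [rt_one]⟩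
  | tail _ hs ih =>
    obtain ⟨Q, hQ⟩ := ih
    rcases hs with ⟨g, rfl⟩ | rfl | rfl
    · exact ⟨D.ι g * Q, by rw [rt_mul, ← ty_rt_ι, hQ]⟩
    · exact ⟨D.y * Q, by rw [rt_mul, ty_rt_y, hQ]⟩
    · exact ⟨D.t * Q, by rw [rt_mul, ← ty_rt_t, hQ]⟩

omit [DecidableEq A] in
/-- **Same block in `(G, c)` ↔ same block in the model.** [folklore] -/
private theorem exists_rt_iff_reach (Ψ Ψ' : CMF G c) : (∃ Q : G, rt c Q Ψ = Ψ') ↔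
    Relation.ReflTransGen (fun Θ₁ Θ₂ : Ty₄ A => (∃ g : ZMod 2 × A, Θ₂ = twH₄ A g Θ₁) ∨ Θ₂ = twZ A ζ Θ₁ ∨ Θ₂ = twT A Θ₁)
      (ty D Ψ) (ty D Ψ') := by
  constructor
  · rintro ⟨Q, rfl⟩
    obtain ⟨k, a, rfl⟩ := exists_word D Q
    have hH : ∀ X : CMF G c, Relation.ReflTransGen
        (fun Θ₁ Θ₂ : Ty₄ A => (∃ g : ZMod 2 × A, Θ₂ = twH₄ A g Θ₁) ∨ Θ₂ = twZ A ζ Θ₁ ∨ Θ₂ = twT A Θ₁) (ty D X) (ty D (rt c (D.ι a) X)) :=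
      fun X => Relation.ReflTransGen.single (Or.inl ⟨a, (ty_rt_ι D a X).symm⟩)
    have hY : ∀ X : CMF G c, Relation.ReflTransGen
        (fun Θ₁ Θ₂ : Ty₄ A => (∃ g : ZMod 2 × A, Θ₂ = twH₄ A g Θ₁) ∨ Θ₂ = twZ A ζ Θ₁ ∨ Θ₂ = twT A Θ₁) (ty D X) (ty D (rt c D.y X)) :=
      fun X => Relation.ReflTransGen.single (Or.inr (Or.inl (ty_rt_y D X)))
    have hT : ∀ X : CMF G c, Relation.ReflTransGen
        (fun Θ₁ Θ₂ : Ty₄ A => (∃ g : ZMod 2 × A, Θ₂ = twH₄ A g Θ₁) ∨ Θ₂ = twZ A ζ Θ₁ ∨ Θ₂ = twT A Θ₁) (ty D X) (ty D (rt c D.t X)) :=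
      fun X => Relation.ReflTransGen.single (Or.inr (Or.inr (ty_rt_t D X).symm))
    fin_cases k
    · exact hH Ψ
    · show Relation.ReflTransGen _ (ty D Ψ) (ty D (rt c (D.y * D.ι a) Ψ))
      rw [rt_mul]; exact (hH Ψ).trans (hY _)
    · show Relation.ReflTransGen _ (ty D Ψ) (ty D (rt c (D.t * D.ι a) Ψ))
      rw [rt_mul]; exact (hH Ψ).trans (hT _)
    · show Relation.ReflTransGen _ (ty D Ψ) (ty D (rt c (D.t * (D.y * D.ι a)) Ψ))
      rw [rt_mul, rt_mul]; exact ((hH Ψ).trans (hY _)).trans (hT _)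
  · intro h
    obtain ⟨Q, hQ⟩ := exists_rt_of_reach D Ψ h
    exact ⟨Q, ty_injective D hQ⟩

/-- **The blocks of `(G, c)` are the blocks of the model**: `Block c ≃ Block A ζ`. [folklore] -/
def blockEquiv : BlockParity.Block c ≃ Block A ζ :=
  Quotient.congr (typeEquiv D) fun Ψ Ψ' => exists_rt_iff_reach D Ψ Ψ'

include D in
/-- **`#Block A ζ = β(G, c)`.** [folklore] -/
theorem card_block_eq : Fintype.card (Block A ζ) = Fintype.card (BlockParity.Block c) := (Fintype.card_congr (blockEquiv D)).symm

/-! ## §7 The transported count -/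

include D in
/-- The abstract faces attached to a family of model faces are `G`-faces. [folklore] -/
theorem image_gfOf_subset_gfaceSet (hc2 : c * c = 1) {F : Finset (Ty₄ A → ℤ)} (hF : ∀ f ∈ F, ∃ Θ p q, p ≠ q ∧ f = faceVec₄ A Θ p q) :
    (↑(F.image (gfOf D hc2)) : Set (CMF G c →₀ ℤ)) ⊆ gfaceSet G c hc2 := by
  intro y hy
  obtain ⟨f, hf, rfl⟩ := Finset.mem_image.mp (Finset.mem_coe.mp hy)
  exact (gfOf_spec D hc2 (hF f hf)).1

include D in
/-- **Transport of a generating family of model faces.**  If the `G'_ζ(B)`-translates of a finite family `F` of model faces, together with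
the pairs, span `hodge₄`, then the base changes of the attached abstract faces `F.image gfOf` span `hodgeSpan c` together with the pairs. [folklore] -/
theorem hodgeSpan_le_of_family (hc2 : c * c = 1) {F : Finset (Ty₄ A → ℤ)} (hF : ∀ f ∈ F, ∃ Θ p q, p ≠ q ∧ f = faceVec₄ A Θ p q)
    (hgen : hodge₄ A ≤ pairs₄ A ⊔ orbSpan A ζ ↑F) :
    hodgeSpan c hc2 ≤ Submodule.span ℤ (pairSet c) ⊔ Submodule.span ℤ (translates c (F.image (gfOf D hc2))) := by
  set S' := F.image (gfOf D hc2) with hS'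
  set T : Submodule ℤ (CMF G c →₀ ℤ) := Submodule.span ℤ (pairSet c) ⊔ Submodule.span ℤ (translates c S') with hT
  have hTstab : ∀ Q : G, ∀ x ∈ T, Finsupp.mapDomain (rt c Q) x ∈ T := by
    intro Q x hx
    obtain ⟨x₁, h₁, x₂, h₂, rfl⟩ := Submodule.mem_sup.mp hx
    rw [Finsupp.mapDomain_add]
    exact Submodule.add_mem _
      (Submodule.mem_sup_left (span_pairSet_map_rt_le D Q (Submodule.mem_map_of_mem (f := Finsupp.lmapDomain ℤ ℤ (rt c Q)) h₁)))
      (Submodule.mem_sup_right (TwistGeneration.mapDomain_rt_mem_span_translates c Q S' h₂))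
  have horb : orbSpan A ζ ↑F ≤ T.comap (tr D : (Ty₄ A → ℤ) →ₗ[ℤ] (CMF G c →₀ ℤ)) := by
    refine orbSpan_le A ζ ?_ ?_ ?_ ?_
    · intro f hf
      obtain ⟨hS, hp⟩ := gfOf_spec D hc2 (hF f hf)
      have hmem : gfOf D hc2 f ∈ S' := Finset.mem_image_of_mem _ hf
      have e : tr D f = gfOf D hc2 f + (tr D f - gfOf D hc2 f) := by abel
      show (tr D : (Ty₄ A → ℤ) →ₗ[ℤ] (CMF G c →₀ ℤ)) f ∈ T
      rw [LinearEquiv.coe_coe, e]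
      refine Submodule.add_mem _ (Submodule.mem_sup_right (Submodule.subset_span ⟨1, _, hmem, ?_⟩)) (Submodule.mem_sup_left hp)
      rw [show rt c (1 : G) = id from funext (rt_one c), Finsupp.mapDomain_id]
    · intro g v hv
      show (tr D : (Ty₄ A → ℤ) →ₗ[ℤ] (CMF G c →₀ ℤ)) (translH₄ A g v) ∈ T
      rw [LinearEquiv.coe_coe, tr_translH₄]; exact hTstab _ _ hv
    · intro v hv
      show (tr D : (Ty₄ A → ℤ) →ₗ[ℤ] (CMF G c →₀ ℤ)) (translZ A ζ v) ∈ T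
      rw [LinearEquiv.coe_coe, tr_translZ]; exact hTstab _ _ hv
    · intro v hv
      show (tr D : (Ty₄ A → ℤ) →ₗ[ℤ] (CMF G c →₀ ℤ)) (translT A v) ∈ T
      rw [LinearEquiv.coe_coe, tr_translT]; exact hTstab _ _ hv
  have hmap : (hodge₄ A).map (tr D : (Ty₄ A → ℤ) →ₗ[ℤ] (CMF G c →₀ ℤ)) ≤ T := by
    refine (Submodule.map_mono hgen).trans ?_
    rw [Submodule.map_sup, map_pairs₄]
    exact sup_le le_sup_left (Submodule.map_le_iff_le_comap.mpr horb)
  refine sup_le (Submodule.span_le.mpr ?_) le_sup_left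
  rintro y ⟨Φ, t, t', ht', rfl⟩
  exact (sup_le hmap le_sup_left) (gface_mem D hc2 Φ ht' (A := A))

end

end Summit.HodgeConjecture.CorCM.Census.OcticProduct
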